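/-
Copyright (c) 2026 the pub-hodgecm-mathlib formalisation cell (harness21).  Prover seat hodgecm-mathlib-K2Liu-p13 (g0), Track B «K2-LIT»,
#184♮ = hLiu418 = `stmt-HodgeConjecture-24832`; LEAD F0P6-plan (g12) RULING «M-156n» (5) 2026-09-04T08:09:40Z «(CC-1) DISCHARGE ROAD = K2Liu-p13 BRICKS 1–3»;
co-dealer K2E5-plan (g6) «=» 08:09:27Z; CENSUS-FIRST `K2/K2Liu-p13/g0/CENSUS-FIRST-U1stage12.K2Liu-p13-g0.md` 0da41888f0faf34c, BRICK 3.
-/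
import Summits.HodgeConjecture.HodgeConjecture.Theorems.K2LiuIsStdPlaceAdapted              -- ★ BRICK 2: `exists_isStd_placeAdapted`, component lemmas
import Literature.NumberTheory.K2Lit.SiegelStandardExtension                                 -- ★ O42.3d: `stdExtension`, `pPart`, `kPart`
import Summits.HodgeConjecture.HodgeConjecture.Theorems.K2LiuIwasawaDeltaUnimodular           -- ★ every Iwasawa datum is `Δ`-unimodular
import Summits.HodgeConjecture.HodgeConjecture.Theorems.K2LiuDoublingHeightQuasiFactorization  -- ★ `commute_locToAdelic_of_evalPlace_eq_one`, `evalPlace_finPart_mul_inv_locToAdelic`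
import HarnessLib

/-!
# Crux `HLiu418`, Road I v3, organ U1 (stage 1), BRICK 3: THE STANDARD EXTENSION ALONG A `v`-ADAPTED DATUM FACTORISES AT `v`
# (modulus of the `P_Δ`-part = away-from-`v` modulus × local modulus; `K₀`-slices are flat; slices are local Siegel sections)

Cell `hodgecm-mathlib`, crux item hLiu418 = `stmt-HodgeConjecture-24832`, route `HCCMUnconditional`; squad K2 ∕ K2Liu, LEAD F0P6-plan (g12), co-dealer
K2E5-plan (g6); prover seat K2Liu-p13 (g0).  THEOREMS ONLY (no `def`, no instance, no notation, no named-fact hypothesis, no `sorry`); lane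
`--supports stmt-HodgeConjecture-24832 --as helper` (count-neutral).  Third brick of the (CC-1) hand-over after ★ `K2LiuStdExtensionDatumMonotone` (p858512:
`stdExtension 𝒦⁺ = stdExtension 𝒦` for `𝒦 ≤ 𝒦⁺`) and ★ `K2LiuIsStdPlaceAdapted` (p858668: every standard `𝒦` sits in a `v`-ADAPTED standard `𝒦⁺`).

SETTING.  An Iwasawa datum `𝒦` of `H(𝔸)` (it is the `𝒦⁺` of BRICK 2) that is SATURATED AT THE FINITE PLACE `v` for a subgroup `K₀ ≤ H(L⁺_v)`:
  (S1) `ι_v(K₀) ⊆ 𝒦.K`   and   (S2) `(k_f)_v ∈ K₀` for every `k ∈ 𝒦.K`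
(exactly the last two conjuncts of ★ `exists_isStd_placeAdapted`; the local Iwasawa decomposition `H_v = P_Δ(L⁺_v)·K₀` is not needed here — the local
decomposition of the `v`-component enters as DATA `h_v = p·k₀`).  Write `ι_v = locToAdelic v`, `h_v = (h_f)_v`, `h^{(v)} := h · ι_v(h_v)⁻¹` (the element with the
`v`-component replaced by `1`).  THEN, for every `φ : H(𝔸) → ℂ` and `s₀`:

* **`exists_decomp_trivialAt`** (T1): an element with trivial `v`-component has an Iwasawa decomposition `h = P·k` with BOTH `P ∈ P_Δ(𝔸)` and `k ∈ 𝒦.K`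
  trivial at `v` (re-balance the chosen decomposition by `ι_v(k_v) = ι_v(P_v⁻¹) ∈ P_Δ(𝔸) ∩ 𝒦.K`);
* **`modDelta_pPart_eq_mul`** (T2): for any local decomposition `h_v = p·k₀` (`p ∈ P_Δ(L⁺_v)`, `k₀ ∈ K₀`):
  `|det_Δ(𝒦.pPart h)| = |det_Δ(𝒦.pPart h^{(v)})| · |det_Δ(ι_v p)|` — the modulus of the `P_Δ`-part FACTORISES into an away-from-`v` and a local factor;
* **`stdExtension_apply_eq_mul`** (T3): `stdExtension 𝒦 s₀ φ s h = |det_Δ(𝒦.pPart h^{(v)})|^{2(s−s₀)} · |det_Δ(ι_v p)|^{2(s−s₀)} · φ h`;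
* **`stdExtension_mul_locToAdelic_of_mem`** (T4, FLAT SLICES): for `x` trivial at `v` and `k₀ ∈ K₀`:
  `stdExtension 𝒦 s₀ φ s (x·ι_v k₀) = |det_Δ(𝒦.pPart x)|^{2(s−s₀)} · φ (x·ι_v k₀)` — on `K₀` the `v`-slice of the standard family is the `v`-slice of `φ` times a
  scalar NOT depending on `k₀` (this is the `K₀`-flatness the local faces (A4′-R)∕(A4″-KR)∕U1-fin take BY VALUE);
* **`stdExtension_mul_locToAdelic_siegel_mul`** (T5, SLICES ARE LOCAL SECTIONS): for `φ ∈ I(s₀, χ)` (★ `IsSiegelDeltaSection`), `x` trivial at `v`, `p ∈ P_Δ(L⁺_v)`: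
  `stdExtension 𝒦 s₀ φ s (x·ι_v(p·u)) = siegelCharLoc χ v s p · stdExtension 𝒦 s₀ φ s (x·ι_v u)` (★ `siegelCharLoc = siegelDeltaCharacter ∘ ι_v`);
* reused by name: ★ `K2LiuDoublingHeightQuasiFactorization.commute_locToAdelic_of_evalPlace_eq_one` (an element trivial at `v` commutes with `ι_v(H_v)`).

USE.  U5 STEP 0 ∕ U1-fin: with `𝒦⁺, K₀` from ★ `exists_isStd_placeAdapted h𝒦 v` and `gΦ = stdExtension 𝒦 … = stdExtension 𝒦⁺ …` (★ `stdExtension_eq_of_le'`),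
(T4)+(T5) say that for every `x` trivial at `v` the slice `u ↦ gΦ s (x·ι_v u)` is a family of local Siegel sections on `H_v`, flat on the locally-Iwasawa compact
open `K₀` up to the `u`-free scalar `|det_Δ(𝒦⁺.pPart x)|^{2(s−s₀)}` — the by-value input of the local faces; (T2)∕(T3) are the Fubini-ready form for `M_{w}(s)`
(`N_Δ(𝔸) = N_Δ(𝔸^{(v)}) × N_{Δ,v}`).  No socket byte is touched.
[KudlaRallis1994, §1], [Tan1999, §1 p. 166 (`Φ(g,s) = Φ_v ⊗ Φ^v`)], [HarrisKudlaSweet1996, §1 (1.15)–(1.17)], [BorelJacquet1979, §4.1], [GetzHahn2024, Prop. 2.3.1].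
HONEST LABEL.  Count-neutral helper; `HC_CM` is proved only modulo the 7 printed citations (2 remaining named inputs: hLiu418 =
`stmt-HodgeConjecture-24832`, h413 = `stmt-HodgeConjecture-24833`) until rung 0 closes.
-/

set_option autoImplicit false
set_option linter.dupNamespace false -- the mandated namespace repeats `HodgeConjecture.HodgeConjecture`

noncomputable section

open NumberField IsDedekindDomain
open scoped Matrix

namespace Summit.HodgeConjecture.HodgeConjecture.Cruxes.HLiu418.K2LiuStdExtensionPlaceFactorisation

open Literature.NumberTheory.Automorphic hiding IsKFinite
open Literature.NumberTheory.GaloisRepresentations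
open Literature.NumberTheory.GelbartRogawski1991 Literature.NumberTheory.GelbartRogawski1991.GRConstruction
open Literature.NumberTheory.K2Lit.SiegelDoubled
open Summit.HodgeConjecture.HodgeConjecture.Cruxes.HLiu418.K2LiuStdFamilyFactorisable
  (archPart_mul' archPart_inv' finPart_mul' finPart_inv' evalPlace_finPart_mul' evalPlace_finPart_inv' archPart_locToAdelic
    evalPlace_finPart_locToAdelic_self eq_of_archPart_eq_of_finPart_eq)
open Summit.HodgeConjecture.HodgeConjecture.Cruxes.HLiu418.K2LiuIsStdPlaceAdapted (finPart_locToAdelic' evalPlace_finPart_mem_siegelDeltaLoc)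
open Summit.HodgeConjecture.HodgeConjecture.Cruxes.HLiu418.K2LiuIwasawaDeltaUnimodular (IwasawaDatum.modDelta_eq_one_of_mem)
open Summit.HodgeConjecture.HodgeConjecture.Cruxes.HLiu418.K2LiuDoublingHeightQuasiFactorization
  (commute_locToAdelic_of_evalPlace_eq_one evalPlace_finPart_mul_inv_locToAdelic)

variable {L : Type} [Field L] [NumberField L] [IsCMField L]
variable {N M n : ℕ} {e : Fin N × Fin M ≃ Fin n}
  {dV : Fin N → L} {hdV : ∀ i, IsCMField.complexConj L (dV i) = dV i}
  {dW : Fin M → L} {hdW : ∀ i, IsCMField.complexConj L (dW i) = dW i}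
variable (v : HeightOneSpectrum (𝓞 (Fp L)))

/-! ## §1 Reused by name: an element trivial at `v` commutes with `ι_v(H_v)` (★ `K2LiuDoublingHeightQuasiFactorization.commute_locToAdelic_of_evalPlace_eq_one`);
`(h·ι_v(h_v)⁻¹)_v = 1` (★ `evalPlace_finPart_mul_inv_locToAdelic`). -/

/-! ## §2 The re-balanced Iwasawa decomposition of an element trivial at `v` -/

section Saturated

variable {𝒦 : IwasawaDatum L e dV hdV dW hdW} {K₀ : Subgroup (UnitaryGroup.localPi L (IsCMField.complexConj L) (n + n) (hermD L e dV hdV dW hdW) v)}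
  (hsat₁ : ∀ u ∈ K₀, locToAdelic L e dV hdV dW hdW v u ∈ 𝒦.K)
  (hsat₂ : ∀ k : HA L e dV hdV dW hdW, k ∈ 𝒦.K → UnitaryGroup.evalPlace (Fp L) L (IsCMField.complexConj L) (n + n) (hermD L e dV hdV dW hdW) v (UnitaryGroup.finPart (Fp L) L (IsCMField.complexConj L) (n + n) (hermD L e dV hdV dW hdW) k) ∈ K₀)
include hsat₁ hsat₂

set_option maxHeartbeats 800000 in -- measured > 200 000: every `H(𝔸)`-vs-`(adelicGroupData …).Adelic` unification of the component maps is expensive (cf. ★ `K2LiuIsStdPlaceAdapted`, ★ `K2LiuStdFamilyFactorisable`); term-mode `congrArg`/`calc` only, no search tactics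
/-- **(T1) an element TRIVIAL AT `v` decomposes as `h = P·k` with `P ∈ P_Δ(𝔸)`, `k ∈ 𝒦.K` BOTH trivial at `v`** (datum saturated at `v`): from any decomposition
`h = P′k′` put `k := k′·ι_v(k′_v)⁻¹ ∈ 𝒦.K` ((S1),(S2)) and `P := P′·ι_v(k′_v)`; `P′_v k′_v = h_v = 1` makes `ι_v(k′_v) = ι_v(P′_v)⁻¹ ∈ P_Δ(𝔸)` (components of a Siegel
element are Siegel, ★ `evalPlace_finPart_mem_siegelDeltaLoc`). [cite: Tan1999, §1 p. 166] [cite: BorelJacquet1979, §4.1] -/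
theorem exists_decomp_trivialAt {h : HA L e dV hdV dW hdW} (hh : UnitaryGroup.evalPlace (Fp L) L (IsCMField.complexConj L) (n + n) (hermD L e dV hdV dW hdW) v (UnitaryGroup.finPart (Fp L) L (IsCMField.complexConj L) (n + n) (hermD L e dV hdV dW hdW) h) = 1) :
    ∃ P k : HA L e dV hdV dW hdW, IsSiegelDelta L e dV hdV dW hdW P ∧ k ∈ 𝒦.K ∧ UnitaryGroup.evalPlace (Fp L) L (IsCMField.complexConj L) (n + n) (hermD L e dV hdV dW hdW) v (UnitaryGroup.finPart (Fp L) L (IsCMField.complexConj L) (n + n) (hermD L e dV hdV dW hdW) P) = 1 ∧ UnitaryGroup.evalPlace (Fp L) L (IsCMField.complexConj L) (n + n) (hermD L e dV hdV dW hdW) v (UnitaryGroup.finPart (Fp L) L (IsCMField.complexConj L) (n + n) (hermD L e dV hdV dW hdW) k) = 1 ∧ h = P * k := by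
  obtain ⟨P', k', hP', hk', hdec⟩ := 𝒦.iwasawa h
  have hprod : UnitaryGroup.evalPlace (Fp L) L (IsCMField.complexConj L) (n + n) (hermD L e dV hdV dW hdW) v (UnitaryGroup.finPart (Fp L) L (IsCMField.complexConj L) (n + n) (hermD L e dV hdV dW hdW) P') * UnitaryGroup.evalPlace (Fp L) L (IsCMField.complexConj L) (n + n) (hermD L e dV hdV dW hdW) v (UnitaryGroup.finPart (Fp L) L (IsCMField.complexConj L) (n + n) (hermD L e dV hdV dW hdW) k') = 1 :=
    ((evalPlace_finPart_mul' L e dV hdV dW hdW v P' k').symm.trans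
      (congrArg (fun x : HA L e dV hdV dW hdW => UnitaryGroup.evalPlace (Fp L) L (IsCMField.complexConj L) (n + n) (hermD L e dV hdV dW hdW) v (UnitaryGroup.finPart (Fp L) L (IsCMField.complexConj L) (n + n) (hermD L e dV hdV dW hdW) x)) hdec.symm)).trans hh
  have hkv : (UnitaryGroup.evalPlace (Fp L) L (IsCMField.complexConj L) (n + n) (hermD L e dV hdV dW hdW) v (UnitaryGroup.finPart (Fp L) L (IsCMField.complexConj L) (n + n) (hermD L e dV hdV dW hdW) P'))⁻¹ = UnitaryGroup.evalPlace (Fp L) L (IsCMField.complexConj L) (n + n) (hermD L e dV hdV dW hdW) v (UnitaryGroup.finPart (Fp L) L (IsCMField.complexConj L) (n + n) (hermD L e dV hdV dW hdW) k') := (eq_inv_of_mul_eq_one_right hprod).symm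
  -- `ι_v(k′_v) = ι_v(P′_v⁻¹) ∈ P_Δ(𝔸)`
  have hιP : IsSiegelDelta L e dV hdV dW hdW (locToAdelic L e dV hdV dW hdW v (UnitaryGroup.evalPlace (Fp L) L (IsCMField.complexConj L) (n + n) (hermD L e dV hdV dW hdW) v (UnitaryGroup.finPart (Fp L) L (IsCMField.complexConj L) (n + n) (hermD L e dV hdV dW hdW) k'))) :=
    (congrArg (fun y : UnitaryGroup.localPi L (IsCMField.complexConj L) (n + n) (hermD L e dV hdV dW hdW) v => IsSiegelDelta L e dV hdV dW hdW (locToAdelic L e dV hdV dW hdW v y)) hkv).mp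
      ((mem_siegelDeltaLoc_iff L e dV hdV dW hdW v _).1
        ((siegelDeltaLoc L e dV hdV dW hdW v).inv_mem (evalPlace_finPart_mem_siegelDeltaLoc v hP')))
  -- the new `K`-part `k := k′ · ι_v(k′_v)⁻¹`
  have hkK : k' * (locToAdelic L e dV hdV dW hdW v (UnitaryGroup.evalPlace (Fp L) L (IsCMField.complexConj L) (n + n) (hermD L e dV hdV dW hdW) v (UnitaryGroup.finPart (Fp L) L (IsCMField.complexConj L) (n + n) (hermD L e dV hdV dW hdW) k')))⁻¹ ∈ 𝒦.K :=
    𝒦.K.mul_mem hk' (𝒦.K.inv_mem (hsat₁ _ (hsat₂ k' hk')))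
  have hk1 : UnitaryGroup.evalPlace (Fp L) L (IsCMField.complexConj L) (n + n) (hermD L e dV hdV dW hdW) v (UnitaryGroup.finPart (Fp L) L (IsCMField.complexConj L) (n + n) (hermD L e dV hdV dW hdW) (k' * (locToAdelic L e dV hdV dW hdW v (UnitaryGroup.evalPlace (Fp L) L (IsCMField.complexConj L) (n + n) (hermD L e dV hdV dW hdW) v (UnitaryGroup.finPart (Fp L) L (IsCMField.complexConj L) (n + n) (hermD L e dV hdV dW hdW) k')))⁻¹)) = 1 := evalPlace_finPart_mul_inv_locToAdelic L e dV hdV dW hdW v k'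
  refine ⟨P' * locToAdelic L e dV hdV dW hdW v (UnitaryGroup.evalPlace (Fp L) L (IsCMField.complexConj L) (n + n) (hermD L e dV hdV dW hdW) v (UnitaryGroup.finPart (Fp L) L (IsCMField.complexConj L) (n + n) (hermD L e dV hdV dW hdW) k')), k' * (locToAdelic L e dV hdV dW hdW v (UnitaryGroup.evalPlace (Fp L) L (IsCMField.complexConj L) (n + n) (hermD L e dV hdV dW hdW) v (UnitaryGroup.finPart (Fp L) L (IsCMField.complexConj L) (n + n) (hermD L e dV hdV dW hdW) k')))⁻¹, isSiegelDelta_mul L e dV hdV dW hdW hP' hιP, hkK, ?_, hk1, ?_⟩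
  · exact (evalPlace_finPart_mul' L e dV hdV dW hdW v P' _).trans
      ((congrArg (fun y : UnitaryGroup.localPi L (IsCMField.complexConj L) (n + n) (hermD L e dV hdV dW hdW) v => UnitaryGroup.evalPlace (Fp L) L (IsCMField.complexConj L) (n + n) (hermD L e dV hdV dW hdW) v (UnitaryGroup.finPart (Fp L) L (IsCMField.complexConj L) (n + n) (hermD L e dV hdV dW hdW) P') * y) (evalPlace_finPart_locToAdelic_self L e dV hdV dW hdW v _)).trans hprod)
  · -- `P′·ι(k′_v) · (k′·ι(k′_v)⁻¹) = P′·(ι(k′_v)·(k′·ι(k′_v)⁻¹)) = P′·k′` since `k′ ι(k′_v)⁻¹` is trivial at `v` and commutes with `ι(k′_v)`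
    have hcomm := (commute_locToAdelic_of_evalPlace_eq_one L e dV hdV dW hdW v _ hk1 (UnitaryGroup.evalPlace (Fp L) L (IsCMField.complexConj L) (n + n) (hermD L e dV hdV dW hdW) v (UnitaryGroup.finPart (Fp L) L (IsCMField.complexConj L) (n + n) (hermD L e dV hdV dW hdW) k'))).eq
    calc h = P' * k' := hdec
      _ = P' * (k' * (locToAdelic L e dV hdV dW hdW v (UnitaryGroup.evalPlace (Fp L) L (IsCMField.complexConj L) (n + n) (hermD L e dV hdV dW hdW) v (UnitaryGroup.finPart (Fp L) L (IsCMField.complexConj L) (n + n) (hermD L e dV hdV dW hdW) k')))⁻¹ * locToAdelic L e dV hdV dW hdW v (UnitaryGroup.evalPlace (Fp L) L (IsCMField.complexConj L) (n + n) (hermD L e dV hdV dW hdW) v (UnitaryGroup.finPart (Fp L) L (IsCMField.complexConj L) (n + n) (hermD L e dV hdV dW hdW) k'))) := by rw [inv_mul_cancel_right]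
      _ = P' * (locToAdelic L e dV hdV dW hdW v (UnitaryGroup.evalPlace (Fp L) L (IsCMField.complexConj L) (n + n) (hermD L e dV hdV dW hdW) v (UnitaryGroup.finPart (Fp L) L (IsCMField.complexConj L) (n + n) (hermD L e dV hdV dW hdW) k')) * (k' * (locToAdelic L e dV hdV dW hdW v (UnitaryGroup.evalPlace (Fp L) L (IsCMField.complexConj L) (n + n) (hermD L e dV hdV dW hdW) v (UnitaryGroup.finPart (Fp L) L (IsCMField.complexConj L) (n + n) (hermD L e dV hdV dW hdW) k')))⁻¹)) := by rw [hcomm]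
      _ = P' * locToAdelic L e dV hdV dW hdW v (UnitaryGroup.evalPlace (Fp L) L (IsCMField.complexConj L) (n + n) (hermD L e dV hdV dW hdW) v (UnitaryGroup.finPart (Fp L) L (IsCMField.complexConj L) (n + n) (hermD L e dV hdV dW hdW) k')) * (k' * (locToAdelic L e dV hdV dW hdW v (UnitaryGroup.evalPlace (Fp L) L (IsCMField.complexConj L) (n + n) (hermD L e dV hdV dW hdW) v (UnitaryGroup.finPart (Fp L) L (IsCMField.complexConj L) (n + n) (hermD L e dV hdV dW hdW) k')))⁻¹) := by rw [mul_assoc]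

/-! ## §3 The modulus of the `P_Δ`-part factorises at `v` -/

set_option maxHeartbeats 800000 in -- measured > 200 000: every `H(𝔸)`-vs-`(adelicGroupData …).Adelic` unification of the component maps is expensive (cf. ★ `K2LiuIsStdPlaceAdapted`, ★ `K2LiuStdFamilyFactorisable`); term-mode `congrArg`/`calc` only, no search tactics
/-- **(T2) THE MODULUS OF THE `P_Δ`-PART FACTORISES AT `v`**: for any local decomposition `h_v = p·k₀` (`p ∈ P_Δ(L⁺_v)`, `k₀ ∈ K₀`),
`|det_Δ(𝒦.pPart h)| = |det_Δ(𝒦.pPart (h·ι_v(h_v)⁻¹))| · |det_Δ(ι_v p)|` (`𝒦` unimodular along `Δ` — every datum is, ★ `K2LiuIwasawaDeltaUnimodular`).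
[cite: Tan1999, §1 p. 166] [cite: KudlaRallis1994, §1] [cite: BorelJacquet1979, §4.1] -/
theorem modDelta_pPart_eq_mul (hK : 𝒦.IsDeltaUnimodular) (h : HA L e dV hdV dW hdW) {p k₀ : UnitaryGroup.localPi L (IsCMField.complexConj L) (n + n) (hermD L e dV hdV dW hdW) v}
    (hp : p ∈ siegelDeltaLoc L e dV hdV dW hdW v) (hk₀ : k₀ ∈ K₀) (hdec : UnitaryGroup.evalPlace (Fp L) L (IsCMField.complexConj L) (n + n) (hermD L e dV hdV dW hdW) v (UnitaryGroup.finPart (Fp L) L (IsCMField.complexConj L) (n + n) (hermD L e dV hdV dW hdW) h) = p * k₀) :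
    modDelta L e dV hdV dW hdW (𝒦.pPart h) = modDelta L e dV hdV dW hdW (𝒦.pPart (h * (locToAdelic L e dV hdV dW hdW v (UnitaryGroup.evalPlace (Fp L) L (IsCMField.complexConj L) (n + n) (hermD L e dV hdV dW hdW) v (UnitaryGroup.finPart (Fp L) L (IsCMField.complexConj L) (n + n) (hermD L e dV hdV dW hdW) h)))⁻¹)) * modDelta L e dV hdV dW hdW (locToAdelic L e dV hdV dW hdW v p) := by
  obtain ⟨P, k, hP, hk, -, hk1, hx⟩ := exists_decomp_trivialAt v hsat₁ hsat₂ (evalPlace_finPart_mul_inv_locToAdelic L e dV hdV dW hdW v h)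
  have hιp : IsSiegelDelta L e dV hdV dW hdW (locToAdelic L e dV hdV dW hdW v p) := (mem_siegelDeltaLoc_iff L e dV hdV dW hdW v p).1 hp
  -- `h = (P·ι p) · (k·ι k₀)`
  have hh : h = P * locToAdelic L e dV hdV dW hdW v p * (k * locToAdelic L e dV hdV dW hdW v k₀) :=
    calc h = h * (locToAdelic L e dV hdV dW hdW v (UnitaryGroup.evalPlace (Fp L) L (IsCMField.complexConj L) (n + n) (hermD L e dV hdV dW hdW) v (UnitaryGroup.finPart (Fp L) L (IsCMField.complexConj L) (n + n) (hermD L e dV hdV dW hdW) h)))⁻¹ * locToAdelic L e dV hdV dW hdW v (UnitaryGroup.evalPlace (Fp L) L (IsCMField.complexConj L) (n + n) (hermD L e dV hdV dW hdW) v (UnitaryGroup.finPart (Fp L) L (IsCMField.complexConj L) (n + n) (hermD L e dV hdV dW hdW) h)) := (inv_mul_cancel_right h _).symm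
      _ = P * k * locToAdelic L e dV hdV dW hdW v (UnitaryGroup.evalPlace (Fp L) L (IsCMField.complexConj L) (n + n) (hermD L e dV hdV dW hdW) v (UnitaryGroup.finPart (Fp L) L (IsCMField.complexConj L) (n + n) (hermD L e dV hdV dW hdW) h)) := congrArg (fun y : HA L e dV hdV dW hdW => y * locToAdelic L e dV hdV dW hdW v (UnitaryGroup.evalPlace (Fp L) L (IsCMField.complexConj L) (n + n) (hermD L e dV hdV dW hdW) v (UnitaryGroup.finPart (Fp L) L (IsCMField.complexConj L) (n + n) (hermD L e dV hdV dW hdW) h))) hx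
      _ = P * k * locToAdelic L e dV hdV dW hdW v (p * k₀) := congrArg (fun y : UnitaryGroup.localPi L (IsCMField.complexConj L) (n + n) (hermD L e dV hdV dW hdW) v => P * k * locToAdelic L e dV hdV dW hdW v y) hdec
      _ = P * k * (locToAdelic L e dV hdV dW hdW v p * locToAdelic L e dV hdV dW hdW v k₀) := congrArg (fun z : HA L e dV hdV dW hdW => P * k * z) (map_mul _ p k₀)
      _ = P * (k * locToAdelic L e dV hdV dW hdW v p) * locToAdelic L e dV hdV dW hdW v k₀ := by simp only [mul_assoc]
      _ = P * (locToAdelic L e dV hdV dW hdW v p * k) * locToAdelic L e dV hdV dW hdW v k₀ := by rw [(commute_locToAdelic_of_evalPlace_eq_one L e dV hdV dW hdW v _ hk1 p).eq]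
      _ = P * locToAdelic L e dV hdV dW hdW v p * (k * locToAdelic L e dV hdV dW hdW v k₀) := by simp only [mul_assoc]
  calc modDelta L e dV hdV dW hdW (𝒦.pPart h) = modDelta L e dV hdV dW hdW (P * locToAdelic L e dV hdV dW hdW v p) :=
        IwasawaDatum.modDelta_pPart_eq hK (isSiegelDelta_mul L e dV hdV dW hdW hP hιp) (𝒦.K.mul_mem hk (hsat₁ k₀ hk₀)) hh
    _ = modDelta L e dV hdV dW hdW P * modDelta L e dV hdV dW hdW (locToAdelic L e dV hdV dW hdW v p) := modDelta_mul L e dV hdV dW hdW hP hιp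
    _ = modDelta L e dV hdV dW hdW (𝒦.pPart (h * (locToAdelic L e dV hdV dW hdW v (UnitaryGroup.evalPlace (Fp L) L (IsCMField.complexConj L) (n + n) (hermD L e dV hdV dW hdW) v (UnitaryGroup.finPart (Fp L) L (IsCMField.complexConj L) (n + n) (hermD L e dV hdV dW hdW) h)))⁻¹)) * modDelta L e dV hdV dW hdW (locToAdelic L e dV hdV dW hdW v p) :=
        congrArg (fun r : ℝ => r * modDelta L e dV hdV dW hdW (locToAdelic L e dV hdV dW hdW v p)) (IwasawaDatum.modDelta_pPart_eq hK hP hk hx).symm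

/-- **(T3) THE STANDARD EXTENSION FACTORISES AT `v`**: `stdExtension 𝒦 s₀ φ s h = |det_Δ(𝒦.pPart h^{(v)})|^{2(s−s₀)} · |det_Δ(ι_v p)|^{2(s−s₀)} · φ h` for any
local decomposition `h_v = p·k₀`. [cite: KudlaRallis1994, §1] [cite: Tan1999, §1 p. 166] [cite: HarrisKudlaSweet1996, §1 (1.17)] -/
theorem stdExtension_apply_eq_mul (hK : 𝒦.IsDeltaUnimodular) (s₀ : ℂ) (φ : HA L e dV hdV dW hdW → ℂ) (s : ℂ) (h : HA L e dV hdV dW hdW) {p k₀ : UnitaryGroup.localPi L (IsCMField.complexConj L) (n + n) (hermD L e dV hdV dW hdW) v}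
    (hp : p ∈ siegelDeltaLoc L e dV hdV dW hdW v) (hk₀ : k₀ ∈ K₀) (hdec : UnitaryGroup.evalPlace (Fp L) L (IsCMField.complexConj L) (n + n) (hermD L e dV hdV dW hdW) v (UnitaryGroup.finPart (Fp L) L (IsCMField.complexConj L) (n + n) (hermD L e dV hdV dW hdW) h) = p * k₀) :
    stdExtension 𝒦 s₀ φ s h =
      ((modDelta L e dV hdV dW hdW (𝒦.pPart (h * (locToAdelic L e dV hdV dW hdW v (UnitaryGroup.evalPlace (Fp L) L (IsCMField.complexConj L) (n + n) (hermD L e dV hdV dW hdW) v (UnitaryGroup.finPart (Fp L) L (IsCMField.complexConj L) (n + n) (hermD L e dV hdV dW hdW) h)))⁻¹)) : ℝ) : ℂ) ^ (2 * (s - s₀)) *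
        (((modDelta L e dV hdV dW hdW (locToAdelic L e dV hdV dW hdW v p) : ℝ) : ℂ) ^ (2 * (s - s₀)) * φ h) := by
  rw [stdExtension, modDelta_pPart_eq_mul v hsat₁ hsat₂ hK h hp hk₀ hdec, Complex.ofReal_mul,
    Complex.mul_cpow_ofReal_nonneg (le_of_lt (modDelta_pos L e dV hdV dW hdW _)) (le_of_lt (modDelta_pos L e dV hdV dW hdW _)), mul_assoc]

set_option maxHeartbeats 800000 in -- measured > 200 000: every `H(𝔸)`-vs-`(adelicGroupData …).Adelic` unification of the component maps is expensive (cf. ★ `K2LiuIsStdPlaceAdapted`, ★ `K2LiuStdFamilyFactorisable`); term-mode `congrArg`/`calc` only, no search tactics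
/-- **(T4) `K₀`-SLICES ARE FLAT**: for `x` trivial at `v` and `k₀ ∈ K₀`, `stdExtension 𝒦 s₀ φ s (x·ι_v k₀) = |det_Δ(𝒦.pPart x)|^{2(s−s₀)} · φ (x·ι_v k₀)` — the
`s`-dependence of the `v`-slice on `K₀` is a scalar free of `k₀`. [cite: Tan1999, §1 p. 166] [cite: HarrisKudlaSweet1996, §1 (1.17)] -/
theorem stdExtension_mul_locToAdelic_of_mem (hK : 𝒦.IsDeltaUnimodular) (s₀ : ℂ) (φ : HA L e dV hdV dW hdW → ℂ) (s : ℂ) {x : HA L e dV hdV dW hdW}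
    (hx : UnitaryGroup.evalPlace (Fp L) L (IsCMField.complexConj L) (n + n) (hermD L e dV hdV dW hdW) v (UnitaryGroup.finPart (Fp L) L (IsCMField.complexConj L) (n + n) (hermD L e dV hdV dW hdW) x) = 1) {k₀ : UnitaryGroup.localPi L (IsCMField.complexConj L) (n + n) (hermD L e dV hdV dW hdW) v} (hk₀ : k₀ ∈ K₀) :
    stdExtension 𝒦 s₀ φ s (x * locToAdelic L e dV hdV dW hdW v k₀) = ((modDelta L e dV hdV dW hdW (𝒦.pPart x) : ℝ) : ℂ) ^ (2 * (s - s₀)) * φ (x * locToAdelic L e dV hdV dW hdW v k₀) := by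
  have hdec : UnitaryGroup.evalPlace (Fp L) L (IsCMField.complexConj L) (n + n) (hermD L e dV hdV dW hdW) v (UnitaryGroup.finPart (Fp L) L (IsCMField.complexConj L) (n + n) (hermD L e dV hdV dW hdW) (x * locToAdelic L e dV hdV dW hdW v k₀)) = 1 * k₀ :=
    (evalPlace_finPart_mul' L e dV hdV dW hdW v x _).trans
      (((congrArg (fun y : UnitaryGroup.localPi L (IsCMField.complexConj L) (n + n) (hermD L e dV hdV dW hdW) v => y * UnitaryGroup.evalPlace (Fp L) L (IsCMField.complexConj L) (n + n) (hermD L e dV hdV dW hdW) v (UnitaryGroup.finPart (Fp L) L (IsCMField.complexConj L) (n + n) (hermD L e dV hdV dW hdW) (locToAdelic L e dV hdV dW hdW v k₀))) hx)).trans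
        (congrArg (fun y : UnitaryGroup.localPi L (IsCMField.complexConj L) (n + n) (hermD L e dV hdV dW hdW) v => 1 * y) (evalPlace_finPart_locToAdelic_self L e dV hdV dW hdW v k₀)))
  have hx' : x * locToAdelic L e dV hdV dW hdW v k₀ * (locToAdelic L e dV hdV dW hdW v (UnitaryGroup.evalPlace (Fp L) L (IsCMField.complexConj L) (n + n) (hermD L e dV hdV dW hdW) v (UnitaryGroup.finPart (Fp L) L (IsCMField.complexConj L) (n + n) (hermD L e dV hdV dW hdW) (x * locToAdelic L e dV hdV dW hdW v k₀))))⁻¹ = x :=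
    (congrArg (fun y : UnitaryGroup.localPi L (IsCMField.complexConj L) (n + n) (hermD L e dV hdV dW hdW) v => x * locToAdelic L e dV hdV dW hdW v k₀ * (locToAdelic L e dV hdV dW hdW v y)⁻¹) hdec).trans (by rw [one_mul, mul_inv_cancel_right])
  rw [stdExtension_apply_eq_mul v hsat₁ hsat₂ hK s₀ φ s (x * locToAdelic L e dV hdV dW hdW v k₀) (siegelDeltaLoc L e dV hdV dW hdW v).one_mem hk₀ hdec, hx', map_one,
    modDelta_one', Complex.ofReal_one, Complex.one_cpow, one_mul]

/-- (T4′) in particular on `K₀` two slices of the family at different parameters are PROPORTIONAL with a `k₀`-free ratio: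
`φ (x·ι_v k₀) · stdExtension 𝒦 s₀ φ s (x·ι_v k₀′) = φ (x·ι_v k₀′) · stdExtension 𝒦 s₀ φ s (x·ι_v k₀)`. [cite: Tan1999, §1 p. 166] -/
theorem stdExtension_slice_cross (hK : 𝒦.IsDeltaUnimodular) (s₀ : ℂ) (φ : HA L e dV hdV dW hdW → ℂ) (s : ℂ) {x : HA L e dV hdV dW hdW}
    (hx : UnitaryGroup.evalPlace (Fp L) L (IsCMField.complexConj L) (n + n) (hermD L e dV hdV dW hdW) v (UnitaryGroup.finPart (Fp L) L (IsCMField.complexConj L) (n + n) (hermD L e dV hdV dW hdW) x) = 1) {k₀ k₀' : UnitaryGroup.localPi L (IsCMField.complexConj L) (n + n) (hermD L e dV hdV dW hdW) v} (hk₀ : k₀ ∈ K₀) (hk₀' : k₀' ∈ K₀) :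
    φ (x * locToAdelic L e dV hdV dW hdW v k₀) * stdExtension 𝒦 s₀ φ s (x * locToAdelic L e dV hdV dW hdW v k₀') = φ (x * locToAdelic L e dV hdV dW hdW v k₀') * stdExtension 𝒦 s₀ φ s (x * locToAdelic L e dV hdV dW hdW v k₀) := by
  rw [stdExtension_mul_locToAdelic_of_mem v hsat₁ hsat₂ hK s₀ φ s hx hk₀, stdExtension_mul_locToAdelic_of_mem v hsat₁ hsat₂ hK s₀ φ s hx hk₀']
  ring

end Saturated

/-! ## §4 Slices are local Siegel sections -/

/-- **(T5) THE `v`-SLICE OF A STANDARD FAMILY IS A LOCAL SIEGEL SECTION**: for `φ ∈ I(s₀, χ)` (★ `IsSiegelDeltaSection`), `x` trivial at `v`, `p ∈ P_Δ(L⁺_v)`: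
`stdExtension 𝒦 s₀ φ s (x·ι_v(p·u)) = siegelCharLoc χ v s p · stdExtension 𝒦 s₀ φ s (x·ι_v u)` (`x` commutes with `ι_v p`; ★ `isSiegelDeltaSection_stdExtension`).
[cite: KudlaRallis1994, §1] [cite: HarrisKudlaSweet1996, §1 (1.15)] [cite: Kudla1994, §3] -/
theorem stdExtension_mul_locToAdelic_siegel_mul {𝒦 : IwasawaDatum L e dV hdV dW hdW} (hK : 𝒦.IsDeltaUnimodular) {χ : HeckeCharacter L} {s₀ : ℂ}
    {φ : HA L e dV hdV dW hdW → ℂ} (hφ : IsSiegelDeltaSection L e dV hdV dW hdW χ s₀ φ) (s : ℂ) {x : HA L e dV hdV dW hdW} (hx : UnitaryGroup.evalPlace (Fp L) L (IsCMField.complexConj L) (n + n) (hermD L e dV hdV dW hdW) v (UnitaryGroup.finPart (Fp L) L (IsCMField.complexConj L) (n + n) (hermD L e dV hdV dW hdW) x) = 1)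
    {p : UnitaryGroup.localPi L (IsCMField.complexConj L) (n + n) (hermD L e dV hdV dW hdW) v} (hp : p ∈ siegelDeltaLoc L e dV hdV dW hdW v) (u : UnitaryGroup.localPi L (IsCMField.complexConj L) (n + n) (hermD L e dV hdV dW hdW) v) :
    stdExtension 𝒦 s₀ φ s (x * locToAdelic L e dV hdV dW hdW v (p * u)) = siegelCharLoc L e dV hdV dW hdW v χ s p * stdExtension 𝒦 s₀ φ s (x * locToAdelic L e dV hdV dW hdW v u) := by
  have hιp : IsSiegelDelta L e dV hdV dW hdW (locToAdelic L e dV hdV dW hdW v p) := (mem_siegelDeltaLoc_iff L e dV hdV dW hdW v p).1 hp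
  have hrew : x * locToAdelic L e dV hdV dW hdW v (p * u) = locToAdelic L e dV hdV dW hdW v p * (x * locToAdelic L e dV hdV dW hdW v u) := by
    rw [map_mul, ← mul_assoc, (commute_locToAdelic_of_evalPlace_eq_one L e dV hdV dW hdW v _ hx p).eq, mul_assoc]
  rw [hrew]
  exact isSiegelDeltaSection_stdExtension hK hφ s _ hιp _

/-- (T5′) the same with the unimodularity clause DISCHARGED on a non-degenerate frame (★ `K2LiuIwasawaDeltaUnimodular`). [cite: KudlaRallis1994, §1] -/
theorem stdExtension_mul_locToAdelic_siegel_mul' (hdV0 : ∀ i, dV i ≠ 0) (hdW0 : ∀ i, dW i ≠ 0) {𝒦 : IwasawaDatum L e dV hdV dW hdW}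
    {χ : HeckeCharacter L} {s₀ : ℂ} {φ : HA L e dV hdV dW hdW → ℂ} (hφ : IsSiegelDeltaSection L e dV hdV dW hdW χ s₀ φ) (s : ℂ) {x : HA L e dV hdV dW hdW}
    (hx : UnitaryGroup.evalPlace (Fp L) L (IsCMField.complexConj L) (n + n) (hermD L e dV hdV dW hdW) v (UnitaryGroup.finPart (Fp L) L (IsCMField.complexConj L) (n + n) (hermD L e dV hdV dW hdW) x) = 1) {p : UnitaryGroup.localPi L (IsCMField.complexConj L) (n + n) (hermD L e dV hdV dW hdW) v} (hp : p ∈ siegelDeltaLoc L e dV hdV dW hdW v) (u : UnitaryGroup.localPi L (IsCMField.complexConj L) (n + n) (hermD L e dV hdV dW hdW) v) :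
    stdExtension 𝒦 s₀ φ s (x * locToAdelic L e dV hdV dW hdW v (p * u)) = siegelCharLoc L e dV hdV dW hdW v χ s p * stdExtension 𝒦 s₀ φ s (x * locToAdelic L e dV hdV dW hdW v u) :=
  stdExtension_mul_locToAdelic_siegel_mul v
    (IwasawaDatum.modDelta_eq_one_of_mem L e dV hdV hdV0 dW hdW hdW0 𝒦) hφ s hx hp u

end Summit.HodgeConjecture.HodgeConjecture.Cruxes.HLiu418.K2LiuStdExtensionPlaceFactorisation

end
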